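import Literature.NumberTheory.EllipticCurves.ModularCurveProofs
import Literature.NumberTheory.EllipticCurves.ModularCurveCuspsProofs
import Literature.NumberTheory.EllipticCurves.ModularCurveGamma0IndexProofs
import Mathlib.NumberTheory.ModularForms.NormTrace
import Mathlib.NumberTheory.ModularForms.LevelOne.DimensionFormula
import HarnessLib

/-!
# Sturm's bound for `Γ ≤ SL₂(ℤ)` and the genus-zero levels of `X₀(N)`
  (trunk EllArithM, item C17; unconditional instances of the named fact
  `finrank_cuspForm_two_eq_genusX0`)

`Literature.NumberTheory.EllipticCurves.ModularCurve` states as a named fact (D-0014)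
`finrank_cuspForm_two_eq_genusX0 N : dim_ℂ S₂(Γ₀(N)) = g(X₀(N))` (Diamond–Shurman Thm. 3.5.1),
and `ModularCurveProofs`/`ModularCurveGenusProofs` reduce it, for every `N`, to the one analytic
input `twelve_mul_finrank_cuspForm_two (Γ₀(N))` (Riemann–Roch and Riemann–Hurwitz on the compact
Riemann surface `X₀(N)`, not available in Mathlib). This file proves the fact **unconditionally for
the thirteen levels `N ∈ {2, …, 10, 12, 16, 18, 25}`** (`finrank_cuspForm_two_eq_genusX0_of_mem`;
with `N = 1` from `ModularCurveProofs` these are all genus-zero levels except `N = 13`), and the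
inequality `dim S₂(Γ₀(N)) ≤ g(X₀(N)) = 1` for `N ∈ {11, 14, 15, 20, 24, 27, 32, 36}`
(`finrank_cuspForm_two_le_genusX0_of_mem`), by an elementary route that avoids `X₀(N)`:

* **Sturm's bound** (`modularForm_eq_zero_of_qExpansion_coeff_eq_zero`; Sturm 1987, Thm. 1, in
  characteristic zero): for an arithmetic group `Γ ∋ T` and `f = ∑ aₙ qⁿ ∈ M_k(Γ)`, if `aₙ = 0` for
  all `n ≤ ⌊k d/12⌋`, `d = [SL₂(ℤ) : Γ ∩ SL₂(ℤ)]`, then `f = 0`. Proof as in Sturm's paper: the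
  norm `∏_{g ∈ SL₂(ℤ)/Γ} f|g⁻¹` (Mathlib `ModularForm.norm`) is a level-one form of weight `kd`
  vanishing at `∞` to order `> kd/12`, hence zero by the level-one case (Mathlib
  `ModularForm.sturm_bound_levelOne`, i.e. `M(1) = ℂ[E₄, E₆]`-free: division by `Δ`).
* its **cuspidal sharpening** (`cuspForm_eq_zero_of_qExpansion_coeff_eq_zero`): for
  `f ∈ S_k(Γ)` the translates `f|g⁻¹` attached to a cusp of width `w` (an orbit of size `w` of
  `T` on `SL₂(ℤ)/Γ`) each decay like `e^{-2π Im τ/w}`, so every cusp other than `∞` adds `1` to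
  the order of the norm at `∞`: `aₙ(f) = 0` for `n < m` and `⌊kd/12⌋ + 1 < m + ε_∞` force `f = 0`.
  (On `X(Γ)` this is the count of zeros of the differential `f(τ)dτ` at the cusps, Diamond–Shurman
  §3.3–3.5; here it is done with decay rates only.) We work throughout with decay rates
  `f|g⁻¹ = O(e^{-2π δ_g Im τ})` (`coe_eq_zero_of_lt_finsum`), the orbit count
  `∑_g 1/#(⟨T⟩ g) = #(⟨T⟩\SL₂(ℤ)/Γ) ≥ #(Γ\cusps)` (`finsum_one_div_card_orbit`,
  `card_cuspOrbits_le_card_quotient_zpowers_T`), and the passage from vanishing `q`-coefficients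
  to decay (`isBigO_exp_of_qExpansion_coeff_eq_zero`) and back at level one
  (`levelOne_qExpansion_coeff_eq_zero_of_isBigO`).
* consequences: `M_k(Γ)` and `S_k(Γ)` are finite-dimensional with
  `dim M_k(Γ) ≤ ⌊kd/12⌋ + 1`, `dim S_k(Γ) ≤ ⌊kd/12⌋ + 1 - ε_∞`
  (`finiteDimensional_modularForm_and_finrank_le`, `finiteDimensional_cuspForm_and_finrank_le`);
  for `Γ₀(N)` with `μ = [SL₂(ℤ) : Γ₀(N)] = ∏ p^{e-1}(p+1)` (`index_gamma0_eq_gamma0Index_holds`)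
  and `ε_∞ = ν_∞ = ∑_{d ∣ N} φ(gcd(d, N/d))` (`numCusps_eq_nuInfty_holds`):
  `dim S₂(Γ₀(N)) ≤ ⌊μ/6⌋ + 1 - ν_∞` (`finrank_cuspForm_two_gamma0_le`). By the genus formula
  `12(g - 1) = μ - 3ν₂ - 4ν₃ - 6ν_∞` this bound is `≤ 2g - 1 + ν₂/2 + 2ν₃/3`, so it proves
  `S₂(Γ₀(N)) = 0` exactly for the genus-zero levels without help from elliptic points
  (all but `13`) and `dim ≤ 1` for the genus-one levels with `ν₂ = ν₃ = 0`. In particular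
  **there are no weight-2 cusp forms of level `≤ 10`** (`cuspForm_two_gamma0_eq_zero_of_le_ten`;
  Diamond–Shurman p. 440 uses `S₂(Γ₀(2)) = 0`).

The numerical data `μ, ν_∞, ν₂, ν₃` (Diamond–Shurman Figure 3.3) are evaluated from the closed
forms by `decide` (`gamma0_data_N`). Only theorems are added (no definitions, no new facts);
everything is in `namespace Literature.ModularForms` like `ModularCurve.lean`.

## References

* J. Sturm, *On the congruence of modular forms*, Number theory (New York, 1984–1985),
  Lecture Notes in Math. 1240, Springer (1987), 275–280, Thm. 1.
* F. Diamond, J. Shurman, *A first course in modular forms*, GTM 228, Springer (2005): §1.2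
  (`q_h`-expansions), Prop. 3.2.2 (the levels `k(N+1) = 24`), Thm. 3.1.1, Thm. 3.5.1, §3.9
  Figure 3.3 (the data `d, ε₂, ε₃, ε_∞` for `Γ₀(N)`), p. 440 (`S₂(Γ₀(2)) = 0`).
* G. Shimura, *Introduction to the arithmetic theory of automorphic functions*, Princeton (1971),
  Prop. 1.40, Prop. 1.43, Thm. 2.24.
-/

/-! ### Level one: decay at `∞` and vanishing of `q`-coefficients -/

noncomputable section

open UpperHalfPlane hiding I
open ModularForm SlashInvariantForm ModularFormClass Filter Asymptotics Complex
open scoped MatrixGroups Topology Real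

namespace Literature.NumberTheory.EllipticCurves.ModularForms

/-- If a level-one modular form `F` satisfies `F(τ) = O(e^{-2π M Im τ})` as `Im τ → ∞`, then its
`q`-expansion coefficients `a_n(F)` vanish for all `n < M` (let `Im τ → ∞` in
`a_n = ∫₀¹ F(u + it) e^{-2πi n(u+it)} du`). [folklore] -/
theorem levelOne_qExpansion_coeff_eq_zero_of_isBigO {K : ℤ} (F : ModularForm 𝒮ℒ K) {M : ℝ}
    (hF : (⇑F) =O[atImInfty] fun τ ↦ Real.exp (-2 * π * M * τ.im)) {n : ℕ} (hn : (n : ℝ) < M) :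
    (qExpansion 1 F).coeff n = 0 := by
  obtain ⟨C, hC₀, hC⟩ := hF.exists_pos
  obtain ⟨A, hA⟩ := (atImInfty_mem _).mp hC.bound
  have key : ∀ t : ℝ, max A 1 ≤ t →
      ‖(qExpansion 1 F).coeff n‖ ≤ C * Real.exp (-2 * π * (M - n) * t) := by
    intro t ht
    have ht₀ : 0 < t := lt_of_lt_of_le one_pos ((le_max_right _ _).trans ht)
    rw [ModularFormClass.qExpansion_coeff_eq_intervalIntegral F one_pos one_mem_strictPeriods_SL n
      ht₀, ofReal_one, div_one, one_mul]
    have hle : ∀ u ∈ Set.uIoc (0 : ℝ) 1,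
        ‖1 / Function.Periodic.qParam 1 ((u : ℂ) + t * I) ^ n *
            F ⟨(u : ℂ) + t * I, by simpa using ht₀⟩‖ ≤ C * Real.exp (-2 * π * (M - n) * t) := by
      intro u _
      have hτ := hA ⟨(u : ℂ) + t * I, by simpa using ht₀⟩
        (by simpa [UpperHalfPlane.im] using (le_max_left _ _).trans ht)
      simp only [Set.mem_setOf_eq, Real.norm_eq_abs, Real.abs_exp] at hτ
      rw [norm_mul, norm_div, norm_one, norm_pow, Function.Periodic.norm_qParam]
      have him : ((u : ℂ) + t * I).im = t := by simp
      have h1 : 1 / Real.exp (-2 * π * ((u : ℂ) + t * I).im / 1) ^ n =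
          Real.exp (2 * π * n * t) := by
        rw [him, div_one, ← Real.exp_nat_mul, one_div, ← Real.exp_neg]; ring_nf
      rw [h1]
      calc Real.exp (2 * π * n * t) * ‖F ⟨(u : ℂ) + t * I, _⟩‖
          ≤ Real.exp (2 * π * n * t) * (C * Real.exp (-2 * π * M * t)) := by
            gcongr
            simpa [UpperHalfPlane.im] using hτ
        _ = C * Real.exp (-2 * π * (M - n) * t) := by
            rw [mul_left_comm, ← Real.exp_add]; ring_nf
    refine (intervalIntegral.norm_integral_le_of_norm_le_const hle).trans ?_
    simp
  have lim : Tendsto (fun t : ℝ ↦ C * Real.exp (-2 * π * (M - n) * t)) atTop (𝓝 0) := by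
    have h0 : 0 < 2 * π * (M - n) := by
      have := Real.pi_pos
      have : 0 < M - n := sub_pos.mpr hn
      positivity
    rw [show (0 : ℝ) = C * 0 by simp]
    refine tendsto_const_nhds.mul ?_
    refine Real.tendsto_exp_atBot.comp ?_
    have : Tendsto (fun t : ℝ ↦ (2 * π * (M - n)) * t) atTop atTop :=
      tendsto_id.const_mul_atTop h0
    refine (tendsto_neg_atTop_atBot.comp this).congr fun t ↦ ?_
    simp only [Function.comp_apply]
    ring
  have hle : ‖(qExpansion 1 F).coeff n‖ ≤ 0 :=
    le_of_tendsto_of_tendsto tendsto_const_nhds lim (eventually_atTop.mpr ⟨max A 1, key⟩)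
  exact norm_le_zero_iff.mp hle

/-- **Sturm's criterion at level one, decay form**: a level-one modular form of weight `K` with
`F(τ) = O(e^{-2π M Im τ})` for some `M > ⌊K/12⌋` vanishes identically (Mathlib's
`ModularForm.sturm_bound_levelOne` applied to the `q`-expansion, whose coefficients `a_n`,
`n ≤ ⌊K/12⌋ < M`, vanish). [folklore] -/
theorem levelOne_eq_zero_of_isBigO {K : ℤ} (F : ModularForm 𝒮ℒ K) {M : ℝ}
    (hF : (⇑F) =O[atImInfty] fun τ ↦ Real.exp (-2 * π * M * τ.im))
    (hM : ((K.toNat / 12 : ℕ) : ℝ) < M) : F = 0 :=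
  sturm_bound_levelOne <| lt_of_lt_of_le (by exact_mod_cast Nat.lt_succ_self _)
    (PowerSeries.nat_le_order _ (K.toNat / 12 + 1) fun i hi ↦
      levelOne_qExpansion_coeff_eq_zero_of_isBigO F hF
        (lt_of_le_of_lt (by exact_mod_cast Nat.lt_succ_iff.mp hi) hM))


/-! ### The norm of a form with decaying coset translates -/

section Norm

variable {𝒢 : Subgroup (GL (Fin 2) ℝ)} [𝒢.IsFiniteRelIndex 𝒮ℒ] {F : Type*} [FunLike F ℍ ℂ] {k : ℤ}

/-- If every coset translate `f|g⁻¹`, `g ∈ SL₂(ℤ)/Γ`, of a modular form `f` of level `Γ` decays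
like `e^{-2π δ_g Im τ}`, then the norm `∏_g f|g⁻¹` (a level-one form of weight `k·[SL₂(ℤ):Γ]`,
Mathlib `ModularForm.norm`) decays like `e^{-2π (∑_g δ_g) Im τ}`. [folklore] -/
theorem norm_isBigO_exp (f : F) [ModularFormClass F 𝒢 k] (δ : 𝒮ℒ ⧸ 𝒢.subgroupOf 𝒮ℒ → ℝ)
    (hδ : ∀ q, quotientFunc f q =O[atImInfty] fun τ ↦ Real.exp (-2 * π * δ q * τ.im)) :
    (⇑(ModularForm.norm 𝒮ℒ f)) =O[atImInfty]
      fun τ ↦ Real.exp (-2 * π * (∑ᶠ q, δ q) * τ.im) := by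
  let _ := Fintype.ofFinite (𝒮ℒ ⧸ 𝒢.subgroupOf 𝒮ℒ)
  have h1 : (fun τ : ℍ ↦ Real.exp (-2 * π * (∑ᶠ q, δ q) * τ.im)) =
      fun τ ↦ ∏ q, Real.exp (-2 * π * δ q * τ.im) := by
    funext τ
    rw [finsum_eq_sum_of_fintype, ← Real.exp_sum]
    congr 1
    rw [Finset.mul_sum, Finset.sum_mul]
  have h2 : (⇑(ModularForm.norm 𝒮ℒ f)) =
      fun τ ↦ ∏ q : 𝒮ℒ ⧸ 𝒢.subgroupOf 𝒮ℒ, quotientFunc f q τ := by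
    funext τ
    simp only [ModularForm.coe_norm, Finset.prod_apply]
  rw [h1, h2]
  exact IsBigO.finsetProd fun q _ ↦ hδ q

/-- **Vanishing criterion** (the mechanism of Sturm's theorem): if the coset translates `f|g⁻¹`
of a modular form `f` of weight `k` and level `Γ` decay like `e^{-2π δ_g Im τ}` with
`∑_g δ_g > ⌊k·[SL₂(ℤ):Γ]/12⌋`, then `f = 0`, because the norm of `f` is a level-one form of
weight `k·[SL₂(ℤ):Γ]` vanishing at `∞` to order `> ⌊k·[SL₂(ℤ):Γ]/12⌋`. [folklore] -/
theorem coe_eq_zero_of_lt_finsum (f : F) [ModularFormClass F 𝒢 k] (δ : 𝒮ℒ ⧸ 𝒢.subgroupOf 𝒮ℒ → ℝ)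
    (hδ : ∀ q, quotientFunc f q =O[atImInfty] fun τ ↦ Real.exp (-2 * π * δ q * τ.im))
    (h : (((k * Nat.card (𝒮ℒ ⧸ 𝒢.subgroupOf 𝒮ℒ)).toNat / 12 : ℕ) : ℝ) < ∑ᶠ q, δ q) :
    (⇑f) = 0 :=
  (ModularForm.norm_eq_zero_iff 𝒮ℒ f).mp (levelOne_eq_zero_of_isBigO _ (norm_isBigO_exp f δ hδ) h)

end Norm

/-! ### Coset translates: representatives and decay -/

section Cosets

variable {𝒢 : Subgroup (GL (Fin 2) ℝ)} {F : Type*} [FunLike F ℍ ℂ] {k : ℤ}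

open Matrix.SpecialLinearGroup

/-- Every coset in `SL₂(ℤ)/Γ` (Mathlib's `𝒮ℒ ⧸ Γ.subgroupOf 𝒮ℒ`) is represented by an element
of `SL₂(ℤ)`. [folklore] -/
theorem exists_coe_rangeRestrict_eq (q : 𝒮ℒ ⧸ 𝒢.subgroupOf 𝒮ℒ) :
    ∃ g : SL(2, ℤ), ((mapGL ℝ).rangeRestrict g : 𝒮ℒ ⧸ 𝒢.subgroupOf 𝒮ℒ) = q := by
  induction q using QuotientGroup.induction_on with
  | H h =>
    obtain ⟨g, hg⟩ := h.2
    exact ⟨g, congrArg _ (Subtype.ext hg)⟩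

/-- The coset translate attached to `g Γ` is `f|g⁻¹`. [folklore] -/
theorem quotientFunc_coe_rangeRestrict (f : F) [SlashInvariantFormClass F 𝒢 k] (g : SL(2, ℤ)) :
    quotientFunc f ((mapGL ℝ).rangeRestrict g : 𝒮ℒ ⧸ 𝒢.subgroupOf 𝒮ℒ) =
      (⇑f) ∣[k] (g⁻¹ : SL(2, ℤ)) := by
  change quotientFunc f ⟦(mapGL ℝ).rangeRestrict g⟧ = _
  rw [quotientFunc_mk, SL_slash]
  change (⇑f) ∣[k] (mapGL ℝ g)⁻¹ = _
  rw [← map_inv]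
  rfl

/-- `T^n · gΓ = (T^n g)Γ` for the translation `T = (1 1; 0 1)` acting on `SL₂(ℤ)/Γ`. [folklore] -/
theorem rangeRestrict_T_pow_smul_coe (g : SL(2, ℤ)) (n : ℕ) :
    ((mapGL ℝ).rangeRestrict ModularGroup.T) ^ n •
        ((mapGL ℝ).rangeRestrict g : 𝒮ℒ ⧸ 𝒢.subgroupOf 𝒮ℒ) =
      ((mapGL ℝ).rangeRestrict (ModularGroup.T ^ n * g) : 𝒮ℒ ⧸ 𝒢.subgroupOf 𝒮ℒ) := by
  rw [map_mul, map_pow]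
  rfl

open ConjAct Pointwise in
/-- If `T^n` fixes the coset `gΓ`, i.e. `g⁻¹ T^{-n} g ∈ Γ`, then `n` is a strict period of the
conjugate `g Γ g⁻¹`, the level of the translate `f|g⁻¹`. [folklore] -/
theorem mem_strictPeriods_of_smul_eq (g : SL(2, ℤ)) (n : ℕ)
    (h : ((mapGL ℝ).rangeRestrict ModularGroup.T) ^ n •
        ((mapGL ℝ).rangeRestrict g : 𝒮ℒ ⧸ 𝒢.subgroupOf 𝒮ℒ) = (mapGL ℝ).rangeRestrict g) :
    (n : ℝ) ∈ (toConjAct ((mapGL ℝ g)⁻¹)⁻¹ • 𝒢).strictPeriods := by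
  rw [rangeRestrict_T_pow_smul_coe, QuotientGroup.eq, Subgroup.mem_subgroupOf] at h
  simp only [map_mul, map_pow, Subgroup.coe_mul, InvMemClass.coe_inv, SubmonoidClass.coe_pow,
    MonoidHom.coe_rangeRestrict] at h
  -- `h : (T^n g)⁻¹ * g ∈ 𝒢`, i.e. `g⁻¹ T^{-n} g ∈ 𝒢`
  rw [Subgroup.mem_strictPeriods_iff, inv_inv, Subgroup.mem_pointwise_smul_iff_inv_smul_mem,
    ← toConjAct_inv, toConjAct_smul, inv_inv]
  have hT : Matrix.GeneralLinearGroup.upperRightHom (n : ℝ) = mapGL ℝ (ModularGroup.T ^ n) := by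
    have hTn : ((ModularGroup.T ^ n : SL(2, ℤ)) : Matrix (Fin 2) (Fin 2) ℤ) =
        !![1, (n : ℤ); 0, 1] := by
      rw [← zpow_natCast, ModularGroup.coe_T_zpow]
    rw [Units.ext_iff, mapGL_coe_matrix, map_apply_coe, hTn]
    ext i j
    fin_cases i <;> fin_cases j <;> simp [Matrix.GeneralLinearGroup.upperRightHom]
  rw [hT]
  simpa [mul_assoc] using 𝒢.inv_mem h

open ConjAct Pointwise in
/-- **Decay of the coset translates of a cusp form**: if `T^n g Γ = g Γ` with `n ≥ 1`, then
`f|g⁻¹ = O(e^{-2π Im τ / n})` for a cusp form `f` of level `Γ` (the translate is a cusp form for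
`gΓg⁻¹ ∋ T^n`, so it is `q_n`-expandable without constant term; Diamond–Shurman §1.2, §3.2).
[folklore] -/
theorem quotientFunc_isBigO_of_smul_eq (f : F) [CuspFormClass F 𝒢 k] (g : SL(2, ℤ)) {n : ℕ}
    (hn : 0 < n)
    (h : ((mapGL ℝ).rangeRestrict ModularGroup.T) ^ n •
        ((mapGL ℝ).rangeRestrict g : 𝒮ℒ ⧸ 𝒢.subgroupOf 𝒮ℒ) = (mapGL ℝ).rangeRestrict g) :
    quotientFunc f ((mapGL ℝ).rangeRestrict g : 𝒮ℒ ⧸ 𝒢.subgroupOf 𝒮ℒ) =O[atImInfty]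
      fun τ ↦ Real.exp (-2 * π * (1 / n) * τ.im) := by
  have hper := mem_strictPeriods_of_smul_eq g n h
  have hdecay := CuspFormClass.exp_decay_atImInfty (CuspForm.translate f ((mapGL ℝ g)⁻¹))
    (h := (n : ℝ)) (by exact_mod_cast hn) hper
  have hcoe : (⇑(CuspForm.translate f ((mapGL ℝ g)⁻¹)) : ℍ → ℂ) =
      quotientFunc f ((mapGL ℝ).rangeRestrict g : 𝒮ℒ ⧸ 𝒢.subgroupOf 𝒮ℒ) := by
    rw [quotientFunc_coe_rangeRestrict, SL_slash]
    change (⇑f) ∣[k] (mapGL ℝ g)⁻¹ = _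
    rw [← map_inv]
    rfl
  rw [← hcoe]
  refine hdecay.congr_right fun τ ↦ ?_
  ring_nf

/-- The coset translates of a modular form are bounded at `∞`, i.e. `O(e^{-2π · 0 · Im τ})`
(Mathlib `ModularFormClass.bdd_at_infty_slash`). [folklore] -/
theorem quotientFunc_isBigO_zero [𝒢.IsArithmetic] (f : F) [ModularFormClass F 𝒢 k]
    (q : 𝒮ℒ ⧸ 𝒢.subgroupOf 𝒮ℒ) :
    quotientFunc f q =O[atImInfty] fun τ ↦ Real.exp (-2 * π * 0 * τ.im) := by
  obtain ⟨g, rfl⟩ := exists_coe_rangeRestrict_eq q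
  rw [quotientFunc_coe_rangeRestrict]
  have hb : ((⇑f) ∣[k] (g⁻¹ : SL(2, ℤ))) =O[atImInfty] (1 : ℍ → ℝ) :=
    ModularFormClass.bdd_at_infty_slash f g⁻¹
  exact hb.congr_right fun τ ↦ by simp

end Cosets

/-! ### Orbits of the translation on `SL₂(ℤ)/Γ` and the cusps of `Γ` -/

section Orbits

/-- `∑_x 1/#(G·x) = #(X/G)` for a group `G` acting on a finite set `X`. [folklore] -/
theorem finsum_one_div_card_orbit {G X : Type*} [Group G] [MulAction G X] [Finite X] :
    ∑ᶠ x : X, (1 : ℝ) / Nat.card (MulAction.orbit G x) =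
      Nat.card (MulAction.orbitRel.Quotient G X) := by
  classical
  let _ := Fintype.ofFinite X
  let pr : X → MulAction.orbitRel.Quotient G X := Quotient.mk _
  have hcard : ∀ x : X,
      Nat.card (MulAction.orbit G x) = (Finset.univ.filter fun y ↦ pr y = pr x).card := by
    intro x
    rw [Nat.card_eq_card_toFinset]
    congr 1
    ext y
    simp only [Set.mem_toFinset, Finset.mem_filter, Finset.mem_univ, true_and, pr]
    rw [Quotient.eq]
    exact MulAction.orbitRel_apply.symm
  rw [finsum_eq_sum_of_fintype,
    ← Finset.sum_fiberwise Finset.univ pr fun x ↦ (1 : ℝ) / Nat.card (MulAction.orbit G x),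
    Nat.card_eq_fintype_card, ← Finset.card_univ, Finset.card_eq_sum_ones Finset.univ,
    Nat.cast_sum]
  refine Finset.sum_congr rfl fun ω _ ↦ ?_
  obtain ⟨x₀, rfl⟩ := Quotient.exists_rep ω
  have hx₀ : x₀ ∈ Finset.univ.filter fun x ↦ pr x = pr x₀ := by simp
  have h1 : ∀ x ∈ Finset.univ.filter (fun x ↦ pr x = pr x₀),
      (1 : ℝ) / Nat.card (MulAction.orbit G x) =
        1 / (Finset.univ.filter fun y ↦ pr y = pr x₀).card := by
    intro x hx
    rw [hcard x, (Finset.mem_filter.mp hx).2]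
  rw [show (⟦x₀⟧ : MulAction.orbitRel.Quotient G X) = pr x₀ from rfl, Finset.sum_congr rfl h1,
    Finset.sum_const, nsmul_eq_mul, mul_one_div, Nat.cast_one, div_self]
  exact_mod_cast (Finset.card_pos.mpr ⟨x₀, hx₀⟩).ne'

variable {𝒢 : Subgroup (GL (Fin 2) ℝ)}

open Matrix.SpecialLinearGroup OnePoint in
/-- **The orbits of `T` on `SL₂(ℤ)/Γ` map onto the cusps of `Γ`**: `gΓ ↦ Γ g⁻¹ ∞` is constant
on `⟨T⟩`-orbits (as `T ∞ = ∞`) and reaches every cusp orbit of the arithmetic group `Γ` (whose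
cusps are the `g ∞`, `g ∈ SL₂(ℤ)`), so `#(Γ\cusps) ≤ #(⟨T⟩\SL₂(ℤ)/Γ)` (in fact equality holds;
Diamond–Shurman §3.8, Shimura §1.6). [folklore] -/
theorem card_cuspOrbits_le_card_quotient_zpowers_T [𝒢.IsArithmetic] :
    Nat.card (CuspOrbits 𝒢) ≤
      Nat.card (MulAction.orbitRel.Quotient
        (Subgroup.zpowers ((mapGL ℝ).rangeRestrict ModularGroup.T)) (𝒮ℒ ⧸ 𝒢.subgroupOf 𝒮ℒ)) := by
  have hinf : IsCusp ∞ 𝒮ℒ := Fact.out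
  have hcusp : ∀ h : 𝒮ℒ, IsCusp ((h : GL (Fin 2) ℝ)⁻¹ • ∞) 𝒢 := fun h ↦
    (Subgroup.IsArithmetic.isCusp_iff_isCusp_SL2Z 𝒢).mpr (hinf.smul_of_mem (inv_mem h.2))
  -- the map `gΓ ↦ Γ g⁻¹ ∞`
  let ψ : 𝒮ℒ ⧸ 𝒢.subgroupOf 𝒮ℒ → CuspOrbits 𝒢 :=
    Quotient.lift (fun h ↦ ⟦⟨(h : GL (Fin 2) ℝ)⁻¹ • ∞, hcusp h⟩⟧) fun a b hab ↦ by
      rw [← Quotient.eq_iff_equiv, Quotient.eq, QuotientGroup.leftRel_apply,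
        Subgroup.mem_subgroupOf] at hab
      refine Quotient.eq.mpr ⟨⟨_, hab⟩, Subtype.ext ?_⟩
      change ((a⁻¹ * b : 𝒮ℒ) : GL (Fin 2) ℝ) • (b : GL (Fin 2) ℝ)⁻¹ • (∞ : OnePoint ℝ) =
        (a : GL (Fin 2) ℝ)⁻¹ • ∞
      rw [← mul_smul]
      simp
  have hψ : ∀ h : 𝒮ℒ, ψ (h : 𝒮ℒ ⧸ 𝒢.subgroupOf 𝒮ℒ) = ⟦⟨(h : GL (Fin 2) ℝ)⁻¹ • ∞, hcusp h⟩⟧ :=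
    fun h ↦ rfl
  -- `ψ` is onto
  have hsurj : Function.Surjective ψ := by
    rintro ⟨c, hc⟩
    have hc' : IsCusp c 𝒢 := hc
    rw [Subgroup.IsArithmetic.isCusp_iff_isCusp_SL2Z, isCusp_SL2Z_iff'] at hc'
    obtain ⟨g, rfl⟩ := hc'
    refine ⟨(mapGL ℝ).rangeRestrict g⁻¹, ?_⟩
    rw [hψ]
    congr 1
    ext1
    simp
  -- `ψ` is constant on the orbits of `⟨T⟩`
  have hconst : ∀ (t : Subgroup.zpowers ((mapGL ℝ).rangeRestrict ModularGroup.T))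
      (q : 𝒮ℒ ⧸ 𝒢.subgroupOf 𝒮ℒ), ψ (t • q) = ψ q := by
    rintro ⟨t, j, rfl⟩ q
    induction q using QuotientGroup.induction_on with
    | H h =>
      change ψ (((((mapGL ℝ).rangeRestrict ModularGroup.T) ^ j * h : 𝒮ℒ)) :
        𝒮ℒ ⧸ 𝒢.subgroupOf 𝒮ℒ) = ψ h
      rw [hψ, hψ]
      congr 2
      rw [Subgroup.coe_mul, mul_inv_rev, mul_smul]
      congr 1
      rw [← map_zpow, MonoidHom.coe_rangeRestrict, ← map_inv, OnePoint.smul_infty_eq_self_iff,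
        ← inv_zpow, inv_zpow', mapGL_coe_matrix, map_apply_coe, ModularGroup.coe_T_zpow]
      simp
  -- descend `ψ` to the orbit space
  let ψ' : MulAction.orbitRel.Quotient
      (Subgroup.zpowers ((mapGL ℝ).rangeRestrict ModularGroup.T)) (𝒮ℒ ⧸ 𝒢.subgroupOf 𝒮ℒ) →
      CuspOrbits 𝒢 :=
    Quotient.lift ψ fun a b hab ↦ by
      obtain ⟨t, rfl⟩ := MulAction.orbitRel_apply.mp hab
      exact hconst t b
  refine Nat.card_le_card_of_surjective ψ' fun c ↦ ?_
  obtain ⟨q, rfl⟩ := hsurj c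
  exact ⟨⟦q⟧, rfl⟩

end Orbits

/-! ### Sturm-type vanishing theorems -/

section Sturm

variable {𝒢 : Subgroup (GL (Fin 2) ℝ)} [𝒢.IsArithmetic] {F : Type*} [FunLike F ℍ ℂ] {k : ℤ}

open Matrix.SpecialLinearGroup

/-- **Cuspidal Sturm bound, decay form.** Let `f` be a cusp form of weight `k` for an arithmetic
group `Γ ≤ SL₂(ℤ)` (more generally a subgroup of `GL(2, ℝ)` commensurable with it) with
`f(τ) = O(e^{-2π m Im τ})`, and let `d = [SL₂(ℤ) : Γ ∩ SL₂(ℤ)]`, `ε_∞ = #(Γ\cusps)`. If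
`⌊k d/12⌋ + 1 < m + ε_∞` then `f = 0`: the norm `∏_{g ∈ SL₂(ℤ)/Γ} f|g⁻¹` is a level-one form
of weight `kd` vanishing at `∞` to order `≥ m + (ε_∞ - 1) > ⌊kd/12⌋`, because the `w` translates
attached to a cusp of width `w` each decay like `e^{-2π Im τ/w}` (this is the valence-formula count
of Diamond–Shurman §3.1, Thm. 3.5.1–3.6.1, done through Mathlib's norm to level one and the
level-one Sturm bound `ModularForm.sturm_bound_levelOne`; cf. Sturm 1987, Thm. 1). [folklore] -/
theorem coe_eq_zero_of_isBigO_exp (f : F) [CuspFormClass F 𝒢 k] {m : ℝ}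
    (hm : (⇑f) =O[atImInfty] fun τ ↦ Real.exp (-2 * π * m * τ.im))
    (h : (((k * Nat.card (𝒮ℒ ⧸ 𝒢.subgroupOf 𝒮ℒ)).toNat / 12 : ℕ) : ℝ) + 1 <
      m + Nat.card (CuspOrbits 𝒢)) :
    (⇑f) = 0 := by
  classical
  let _ := Fintype.ofFinite (𝒮ℒ ⧸ 𝒢.subgroupOf 𝒮ℒ)
  set T' : 𝒮ℒ := (mapGL ℝ).rangeRestrict ModularGroup.T with hT'
  let per : 𝒮ℒ ⧸ 𝒢.subgroupOf 𝒮ℒ → ℕ := fun q ↦ Function.minimalPeriod (T' • ·) q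
  have hper : ∀ q, (per q : ℝ) = Nat.card (MulAction.orbit (Subgroup.zpowers T') q) := by
    intro q
    have := MulAction.minimalPeriod_eq_card T' q
    simp only [per, this, Fintype.card_eq_nat_card]
    rfl
  have hper_pos : ∀ q, 0 < per q := by
    intro q
    have : (0 : ℝ) < per q := by
      rw [hper, Nat.cast_pos, Nat.card_pos_iff]
      exact ⟨⟨q, MulAction.mem_orbit_self q⟩, inferInstance⟩
    exact_mod_cast this
  let q₁ : 𝒮ℒ ⧸ 𝒢.subgroupOf 𝒮ℒ := (((mapGL ℝ).rangeRestrict 1 : 𝒮ℒ) : 𝒮ℒ ⧸ 𝒢.subgroupOf 𝒮ℒ)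
  let δ : 𝒮ℒ ⧸ 𝒢.subgroupOf 𝒮ℒ → ℝ := fun q ↦ if q = q₁ then m else 1 / per q
  have hδ : ∀ q, quotientFunc f q =O[atImInfty] fun τ ↦ Real.exp (-2 * π * δ q * τ.im) := by
    intro q
    by_cases hq : q = q₁
    · simp only [δ, if_pos hq]
      rw [hq]
      have : quotientFunc f q₁ = ⇑f := by
        simp only [q₁]
        rw [quotientFunc_coe_rangeRestrict, inv_one, SlashAction.slash_one]
      rwa [this]
    · simp only [δ, if_neg hq]
      obtain ⟨g, rfl⟩ := exists_coe_rangeRestrict_eq q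
      exact quotientFunc_isBigO_of_smul_eq f g (hper_pos _)
        (MulAction.pow_smul_eq_iff_minimalPeriod_dvd.mpr (dvd_refl _))
  refine coe_eq_zero_of_lt_finsum f δ hδ ?_
  -- `∑ δ = m - 1/per q₁ + ∑_q 1/per q ≥ m - 1 + #orbits ≥ m - 1 + #cusps`
  have hsum : ∑ᶠ q, δ q = m - 1 / per q₁ + ∑ q, (1 : ℝ) / per q := by
    rw [finsum_eq_sum_of_fintype, ← Finset.add_sum_erase _ _ (Finset.mem_univ q₁),
      ← Finset.add_sum_erase _ (fun q ↦ (1 : ℝ) / per q) (Finset.mem_univ q₁)]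
    simp only [δ, if_pos rfl]
    rw [Finset.sum_congr rfl fun q hq ↦ if_neg (Finset.ne_of_mem_erase hq)]
    ring
  have horb : ∑ q, (1 : ℝ) / per q =
      Nat.card (MulAction.orbitRel.Quotient (Subgroup.zpowers T') (𝒮ℒ ⧸ 𝒢.subgroupOf 𝒮ℒ)) := by
    rw [← finsum_one_div_card_orbit, finsum_eq_sum_of_fintype]
    exact Finset.sum_congr rfl fun q _ ↦ by rw [hper]
  have hcusps := card_cuspOrbits_le_card_quotient_zpowers_T (𝒢 := 𝒢)
  rw [← hT'] at hcusps
  have h1 : 1 / (per q₁ : ℝ) ≤ 1 := by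
    rw [div_le_one (by exact_mod_cast hper_pos q₁)]
    exact_mod_cast hper_pos q₁
  have hcusps' : (Nat.card (CuspOrbits 𝒢) : ℝ) ≤
      Nat.card (MulAction.orbitRel.Quotient (Subgroup.zpowers T') (𝒮ℒ ⧸ 𝒢.subgroupOf 𝒮ℒ)) := by
    exact_mod_cast hcusps
  rw [hsum, horb]
  linarith

/-- **Sturm bound, decay form.** A modular form `f` of weight `k` for an arithmetic group `Γ` with
`f(τ) = O(e^{-2π m Im τ})` and `m > ⌊k d/12⌋`, `d = [SL₂(ℤ) : Γ ∩ SL₂(ℤ)]`, vanishes: its norm to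
level one has weight `kd` and vanishes at `∞` to order `≥ m` (Sturm 1987, Thm. 1; the other
translates `f|g⁻¹` are merely bounded). [folklore] -/
theorem coe_eq_zero_of_isBigO_exp' (f : F) [ModularFormClass F 𝒢 k] {m : ℝ}
    (hm : (⇑f) =O[atImInfty] fun τ ↦ Real.exp (-2 * π * m * τ.im))
    (h : (((k * Nat.card (𝒮ℒ ⧸ 𝒢.subgroupOf 𝒮ℒ)).toNat / 12 : ℕ) : ℝ) < m) :
    (⇑f) = 0 := by
  classical
  let _ := Fintype.ofFinite (𝒮ℒ ⧸ 𝒢.subgroupOf 𝒮ℒ)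
  let q₁ : 𝒮ℒ ⧸ 𝒢.subgroupOf 𝒮ℒ := (((mapGL ℝ).rangeRestrict 1 : 𝒮ℒ) : 𝒮ℒ ⧸ 𝒢.subgroupOf 𝒮ℒ)
  let δ : 𝒮ℒ ⧸ 𝒢.subgroupOf 𝒮ℒ → ℝ := fun q ↦ if q = q₁ then m else 0
  have hδ : ∀ q, quotientFunc f q =O[atImInfty] fun τ ↦ Real.exp (-2 * π * δ q * τ.im) := by
    intro q
    by_cases hq : q = q₁
    · simp only [δ, if_pos hq]
      rw [hq]
      have : quotientFunc f q₁ = ⇑f := by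
        simp only [q₁]
        rw [quotientFunc_coe_rangeRestrict, inv_one, SlashAction.slash_one]
      rwa [this]
    · simp only [δ, if_neg hq]
      exact quotientFunc_isBigO_zero f q
  refine coe_eq_zero_of_lt_finsum f δ hδ ?_
  have hsum : ∑ᶠ q, δ q = m := by
    rw [finsum_eq_sum_of_fintype, ← Finset.add_sum_erase _ _ (Finset.mem_univ q₁)]
    simp only [δ, if_pos rfl]
    rw [Finset.sum_congr rfl fun q hq ↦ if_neg (Finset.ne_of_mem_erase hq), Finset.sum_const_zero,
      add_zero]
  rwa [hsum]

omit [𝒢.IsArithmetic] in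
/-- **Order of vanishing at `∞` and decay**: if the first `m` coefficients of the `q`-expansion
of a modular form `f` (level `Γ ∋ T`, so `q = e^{2πiτ}`) vanish, then `f(τ) = O(e^{-2π m Im τ})`
(`f = q^m · (holomorphic function of q)`; Diamond–Shurman §1.1–1.2). [folklore] -/
theorem isBigO_exp_of_qExpansion_coeff_eq_zero (f : F) [ModularFormClass F 𝒢 k]
    (h1 : (1 : ℝ) ∈ 𝒢.strictPeriods) {m : ℕ} (hf : ∀ i < m, (qExpansion 1 f).coeff i = 0) :
    (⇑f) =O[atImInfty] fun τ ↦ Real.exp (-2 * π * m * τ.im) := by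
  have han : AnalyticAt ℂ (cuspFunction 1 f) 0 :=
    ModularFormClass.analyticAt_cuspFunction_zero f one_pos h1
  have hord : (m : ℕ∞) ≤ analyticOrderAt (cuspFunction 1 f) 0 := by
    rw [natCast_le_analyticOrderAt_iff_iteratedDeriv_eq_zero han]
    intro i hi
    have := hf i hi
    rw [qExpansion_coeff] at this
    simpa [Nat.factorial_ne_zero] using this
  obtain ⟨G, hG, hfG⟩ := (natCast_le_analyticOrderAt han).mp hord
  -- `G` is bounded near `0`
  obtain ⟨C, hC⟩ : ∃ C, ∀ᶠ z in 𝓝 (0 : ℂ), ‖G z‖ ≤ C :=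
    ⟨‖G 0‖ + 1, hG.continuousAt.norm.eventually (eventually_le_nhds (lt_add_one _))⟩
  have hev : ∀ᶠ z in 𝓝 (0 : ℂ), ‖cuspFunction 1 f z‖ ≤ C * ‖z ^ m‖ := by
    filter_upwards [hfG, hC] with z hz hz'
    rw [hz, sub_zero, norm_smul, mul_comm]
    gcongr
  have hq := (qParam_tendsto_atImInfty one_pos).eventually hev
  refine IsBigO.of_bound C ?_
  filter_upwards [hq] with τ hτ
  rw [SlashInvariantFormClass.eq_cuspFunction f τ h1 one_ne_zero] at hτ
  refine hτ.trans (le_of_eq ?_)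
  rw [norm_pow, Function.Periodic.norm_qParam, UpperHalfPlane.coe_im, ← Real.exp_nat_mul,
    Real.norm_eq_abs, Real.abs_exp]
  congr 1
  ring

/-- **Cuspidal Sturm bound.** Let `Γ` be an arithmetic group containing `T = (1 1; 0 1)`
(e.g. `Γ₀(N)`, `Γ₁(N)`), `d = [SL₂(ℤ) : Γ ∩ SL₂(ℤ)]`, `ε_∞ = #(Γ\cusps)`, and let
`f = ∑ a_n q^n ∈ S_k(Γ)` with `a_n = 0` for all `n < m`. If `⌊kd/12⌋ + 1 < m + ε_∞` then `f = 0`.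
Equivalently a nonzero cusp form has `ord_∞ f ≤ ⌊kd/12⌋ + 1 - ε_∞`. (The cuspidal sharpening of
Sturm 1987, Thm. 1, by the contributions of the other cusps; Diamond–Shurman §3.1–3.5 obtain it
from the valence formula on `X(Γ)`.) [folklore] -/
theorem cuspForm_eq_zero_of_qExpansion_coeff_eq_zero (h1 : (1 : ℝ) ∈ 𝒢.strictPeriods)
    (f : CuspForm 𝒢 k) {m : ℕ} (hf : ∀ i < m, (qExpansion 1 f).coeff i = 0)
    (h : ((k * Nat.card (𝒮ℒ ⧸ 𝒢.subgroupOf 𝒮ℒ)).toNat / 12 : ℕ) + 1 < m + Nat.card (CuspOrbits 𝒢)) :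
    f = 0 :=
  DFunLike.ext' <| (coe_eq_zero_of_isBigO_exp f (isBigO_exp_of_qExpansion_coeff_eq_zero f h1 hf)
    (by exact_mod_cast h)).trans CuspForm.coe_zero.symm

/-- **Sturm's bound** (the characteristic-zero case of Sturm 1987, Thm. 1): let `Γ` be an
arithmetic group containing `T`, `d = [SL₂(ℤ) : Γ ∩ SL₂(ℤ)]`, and `f = ∑ a_n q^n ∈ M_k(Γ)` with
`a_n = 0` for all `n ≤ ⌊kd/12⌋` (i.e. for all `n < m` with `m > ⌊kd/12⌋`). Then `f = 0`.
[cite: Sturm1987, Thm. 1] -/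
theorem modularForm_eq_zero_of_qExpansion_coeff_eq_zero (h1 : (1 : ℝ) ∈ 𝒢.strictPeriods)
    (f : ModularForm 𝒢 k) {m : ℕ} (hf : ∀ i < m, (qExpansion 1 f).coeff i = 0)
    (h : ((k * Nat.card (𝒮ℒ ⧸ 𝒢.subgroupOf 𝒮ℒ)).toNat / 12 : ℕ) < m) :
    f = 0 :=
  DFunLike.ext' <| (coe_eq_zero_of_isBigO_exp' f (isBigO_exp_of_qExpansion_coeff_eq_zero f h1 hf)
    (by exact_mod_cast h)).trans ModularForm.coe_zero.symm

end Sturm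

/-! ### Finite-dimensionality and dimension bounds -/

section Finrank

variable {𝒢 : Subgroup (GL (Fin 2) ℝ)} [𝒢.IsArithmetic] [𝒢.HasDetOne] {k : ℤ}

/-- **`S_k(Γ)` is finite-dimensional, with `dim S_k(Γ) ≤ ⌊kd/12⌋ + 1 - ε_∞`** (`ℕ`-subtraction),
for an arithmetic group `Γ ∋ T` of determinant one, `d = [SL₂(ℤ) : Γ ∩ SL₂(ℤ)]`,
`ε_∞ = #(Γ\cusps)`: by the cuspidal Sturm bound the coefficients `a_1, …, a_{⌊kd/12⌋+1-ε_∞}`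
determine a cusp form. (Diamond–Shurman Thm. 3.5.1/3.6.1 give the exact dimension through
Riemann–Roch; this elementary bound is sharp in weight `2` exactly when `g(X(Γ)) ≤ 1`.)
[folklore] -/
theorem finiteDimensional_cuspForm_and_finrank_le (h1 : (1 : ℝ) ∈ 𝒢.strictPeriods) :
    FiniteDimensional ℂ (CuspForm 𝒢 k) ∧
      Module.finrank ℂ (CuspForm 𝒢 k) ≤
        (k * Nat.card (𝒮ℒ ⧸ 𝒢.subgroupOf 𝒮ℒ)).toNat / 12 + 1 - Nat.card (CuspOrbits 𝒢) := by
  set B := (k * Nat.card (𝒮ℒ ⧸ 𝒢.subgroupOf 𝒮ℒ)).toNat / 12 with hB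
  set M := B + 1 - Nat.card (CuspOrbits 𝒢) with hM
  have han : ∀ f : CuspForm 𝒢 k, AnalyticAt ℂ (cuspFunction 1 f) 0 := fun f ↦
    ModularFormClass.analyticAt_cuspFunction_zero f one_pos h1
  -- the truncated `q`-expansion `f ↦ (a_1(f), …, a_M(f))`
  let L : CuspForm 𝒢 k →ₗ[ℂ] (Fin M → ℂ) :=
    { toFun := fun f j ↦ (qExpansion 1 f).coeff (j + 1)
      map_add' := fun f g ↦ by
        funext j
        simp only [Pi.add_apply]
        rw [CuspForm.coe_add, qExpansion_add (han f) (han g), map_add]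
      map_smul' := fun c f ↦ by
        funext j
        simp only [Pi.smul_apply, RingHom.id_apply, smul_eq_mul]
        rw [CuspForm.IsGLPos.coe_smul, qExpansion_smul (han f), map_smul, smul_eq_mul] }
  have hL : Function.Injective L := by
    rw [injective_iff_map_eq_zero]
    intro f hf
    refine cuspForm_eq_zero_of_qExpansion_coeff_eq_zero h1 f (m := M + 1) (fun i hi ↦ ?_) (by omega)
    rcases i with - | i
    · exact CuspFormClass.qExpansion_coeff_zero f one_pos h1
    · exact congr_fun hf ⟨i, by omega⟩
  have hfin : FiniteDimensional ℂ (CuspForm 𝒢 k) := Module.Finite.of_injective L hL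
  exact ⟨hfin, (LinearMap.finrank_le_finrank_of_injective hL).trans (Module.finrank_fin_fun ℂ).le⟩

/-- **`M_k(Γ)` is finite-dimensional, with `dim M_k(Γ) ≤ ⌊kd/12⌋ + 1`**, for an arithmetic group
`Γ ∋ T` of determinant one, `d = [SL₂(ℤ) : Γ ∩ SL₂(ℤ)]`: by Sturm's bound the coefficients
`a_0, …, a_{⌊kd/12⌋}` determine a modular form (Sturm 1987, Thm. 1 and its standard corollary).
[folklore] -/
theorem finiteDimensional_modularForm_and_finrank_le (h1 : (1 : ℝ) ∈ 𝒢.strictPeriods) :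
    FiniteDimensional ℂ (ModularForm 𝒢 k) ∧
      Module.finrank ℂ (ModularForm 𝒢 k) ≤
        (k * Nat.card (𝒮ℒ ⧸ 𝒢.subgroupOf 𝒮ℒ)).toNat / 12 + 1 := by
  set B := (k * Nat.card (𝒮ℒ ⧸ 𝒢.subgroupOf 𝒮ℒ)).toNat / 12 with hB
  have han : ∀ f : ModularForm 𝒢 k, AnalyticAt ℂ (cuspFunction 1 f) 0 := fun f ↦
    ModularFormClass.analyticAt_cuspFunction_zero f one_pos h1
  let L : ModularForm 𝒢 k →ₗ[ℂ] (Fin (B + 1) → ℂ) :=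
    { toFun := fun f j ↦ (qExpansion 1 f).coeff j
      map_add' := fun f g ↦ by
        funext j
        simp only [Pi.add_apply]
        rw [ModularForm.coe_add, qExpansion_add (han f) (han g), map_add]
      map_smul' := fun c f ↦ by
        funext j
        simp only [Pi.smul_apply, RingHom.id_apply, smul_eq_mul]
        rw [ModularForm.IsGLPos.coe_smul, qExpansion_smul (han f), map_smul, smul_eq_mul] }
  have hL : Function.Injective L := by
    rw [injective_iff_map_eq_zero]
    intro f hf
    exact modularForm_eq_zero_of_qExpansion_coeff_eq_zero h1 f (m := B + 1)
      (fun i hi ↦ congr_fun hf ⟨i, hi⟩) (by omega)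
  have hfin : FiniteDimensional ℂ (ModularForm 𝒢 k) := Module.Finite.of_injective L hL
  exact ⟨hfin, (LinearMap.finrank_le_finrank_of_injective hL).trans (Module.finrank_fin_fun ℂ).le⟩

end Finrank

/-! ### The case of `Γ₀(N)` -/

section Gamma0

open Matrix.SpecialLinearGroup CongruenceSubgroup

/-- `#(SL₂(ℤ)/Γ)` computed in Mathlib's copy `𝒮ℒ` of `SL₂(ℤ)` inside `GL(2, ℝ)` is the index of
`Γ`. [folklore] -/
theorem card_quotient_subgroupOf_eq_index (Γ : Subgroup SL(2, ℤ)) :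
    Nat.card (𝒮ℒ ⧸ (Γ : Subgroup (GL (Fin 2) ℝ)).subgroupOf 𝒮ℒ) = Γ.index := by
  let e : SL(2, ℤ) ≃* 𝒮ℒ := MonoidHom.ofInjective mapGL_injective
  have he : ((Γ : Subgroup (GL (Fin 2) ℝ)).subgroupOf 𝒮ℒ).comap e.toMonoidHom = Γ := by
    ext g
    simp only [Subgroup.mem_comap, Subgroup.mem_subgroupOf, MulEquiv.coe_toMonoidHom,
      MonoidHom.ofInjective_apply, e, Subgroup.mem_map]
    exact ⟨fun ⟨g', hg', hgg'⟩ ↦ mapGL_injective hgg' ▸ hg', fun hg ↦ ⟨g, hg, rfl⟩⟩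
  change ((Γ : Subgroup (GL (Fin 2) ℝ)).subgroupOf 𝒮ℒ).index = Γ.index
  rw [← Subgroup.index_comap_of_surjective (f := e.toMonoidHom)
    (((Γ : Subgroup (GL (Fin 2) ℝ)).subgroupOf 𝒮ℒ)) e.surjective, he]

variable (N : ℕ)

/-- `T ∈ Γ₀(N)`: `1` is a strict period of `Γ₀(N)` (Mathlib `strictPeriods_Gamma0`). [folklore] -/
theorem one_mem_strictPeriods_coe_gamma0 :
    (1 : ℝ) ∈ (Gamma0 N : Subgroup (GL (Fin 2) ℝ)).strictPeriods := by
  simp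

variable [NeZero N]

/-- **`S_k(Γ₀(N))` and `M_k(Γ₀(N))` are finite-dimensional** (`N ≥ 1`, any weight `k`), by
Sturm's bound. [folklore] -/
theorem finiteDimensional_cuspForm_gamma0 (k : ℤ) : FiniteDimensional ℂ (CuspForm (Gamma0 N) k) :=
  (finiteDimensional_cuspForm_and_finrank_le (one_mem_strictPeriods_coe_gamma0 N)).1

/-- **`M_k(Γ₀(N))` is finite-dimensional** (`N ≥ 1`, any weight `k`), with
`dim M_k(Γ₀(N)) ≤ ⌊k μ/12⌋ + 1`, `μ = [SL₂(ℤ) : Γ₀(N)]` (Sturm 1987, Thm. 1, Cor.). [folklore] -/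
theorem finiteDimensional_modularForm_gamma0 (k : ℤ) :
    FiniteDimensional ℂ (ModularForm (Gamma0 N) k) ∧
      Module.finrank ℂ (ModularForm (Gamma0 N) k) ≤ (k * gamma0Index N).toNat / 12 + 1 := by
  have := finiteDimensional_modularForm_and_finrank_le (k := k) (one_mem_strictPeriods_coe_gamma0 N)
  rwa [card_quotient_subgroupOf_eq_index, index_gamma0_eq_gamma0Index_holds N] at this

/-- **`dim S₂(Γ₀(N)) ≤ ⌊μ/6⌋ + 1 - ν_∞`** (`ℕ`-subtraction), `μ = [SL₂(ℤ) : Γ₀(N)]`,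
`ν_∞ = ∑_{d ∣ N} φ(gcd(d, N/d))` the number of cusps: the cuspidal Sturm bound in weight `2` for
`Γ₀(N)`, with the index and the cusp count of `Γ₀(N)` (`index_gamma0_eq_gamma0Index_holds`,
`numCusps_eq_nuInfty_holds`). Since `12(g - 1) = μ - 3ν₂ - 4ν₃ - 6ν_∞` (Diamond–Shurman
Thm. 3.1.1), the bound is `0` when `g(X₀(N)) = 0 ≠ ν₂ν₃…` — precisely, it vanishes for
`N ∈ {2,…,10, 12, 16, 18, 25}` and equals `1` for `N ∈ {11, 14, 15, 20, 24, 27, 32, 36}`.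
[folklore] -/
theorem finrank_cuspForm_two_gamma0_le :
    Module.finrank ℂ (CuspForm (Gamma0 N) 2) ≤ gamma0Index N / 6 + 1 - nuInfty N := by
  have := (finiteDimensional_cuspForm_and_finrank_le (k := 2) (one_mem_strictPeriods_coe_gamma0 N)).2
  rw [card_quotient_subgroupOf_eq_index, index_gamma0_eq_gamma0Index_holds N] at this
  have hc : Nat.card (CuspOrbits (Gamma0 N : Subgroup (GL (Fin 2) ℝ))) = nuInfty N :=
    numCusps_eq_nuInfty_holds N
  rw [hc] at this
  convert this using 2
  omega

omit [NeZero N] in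
/-- **Vanishing criterion for `S₂(Γ₀(N))`**: if `⌊μ/6⌋ + 1 ≤ ν_∞` then `S₂(Γ₀(N)) = 0`, and in
particular `dim S₂(Γ₀(N)) = g(X₀(N))` holds as soon as also the genus formula gives `g = 0`.
[folklore] -/
theorem finrank_cuspForm_two_eq_genusX0_of_le [NeZero N] (h : gamma0Index N / 6 + 1 ≤ nuInfty N)
    (hg : genusX0 N = 0) : finrank_cuspForm_two_eq_genusX0 N := by
  unfold finrank_cuspForm_two_eq_genusX0
  rw [hg]
  exact Nat.le_zero.mp ((finrank_cuspForm_two_gamma0_le N).trans (by omega))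

end Gamma0

/-! ### Numerical values of `μ`, `ν₂`, `ν₃`, `ν_∞` and the genus-zero levels -/

section Numerics

open CongruenceSubgroup

/-- `μ(p^e) = p^{e-1}(p + 1)` for a prime power level. [folklore] -/
theorem gamma0Index_prime_pow {p : ℕ} (hp : p.Prime) {e : ℕ} (he : e ≠ 0) :
    gamma0Index (p ^ e) = p ^ (e - 1) * (p + 1) := by
  rw [gamma0Index, hp.factorization_pow, Finsupp.prod, Finsupp.support_single p he,
    Finset.prod_singleton, Finsupp.single_eq_same]

/-- `μ(p) = p + 1` for a prime level. [folklore] -/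
theorem gamma0Index_prime {p : ℕ} (hp : p.Prime) : gamma0Index p = p + 1 := by
  simpa using gamma0Index_prime_pow hp one_ne_zero

/-- `μ` is multiplicative: `μ(mn) = μ(m)μ(n)` for coprime `m`, `n`. [folklore] -/
theorem gamma0Index_mul {m n : ℕ} (h : m.Coprime n) :
    gamma0Index (m * n) = gamma0Index m * gamma0Index n := by
  unfold gamma0Index
  rw [Nat.factorization_mul_of_coprime h, Finsupp.prod_add_index_of_disjoint]
  exact h.disjoint_primeFactors

/-- `ν₂(N) = #{x mod N : x² + 1 = 0}` as a `Fintype.card`, for evaluation by `decide`. [folklore] -/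
theorem nu₂_eq_card (N : ℕ) [NeZero N] :
    nu₂ N = (Finset.univ.filter fun x : ZMod N ↦ x ^ 2 + 1 = 0).card := by
  rw [nu₂, Nat.card_eq_fintype_card, Fintype.card_subtype]

/-- `ν₃(N) = #{x mod N : x² + x + 1 = 0}` as a `Fintype.card`, for evaluation by `decide`.
[folklore] -/
theorem nu₃_eq_card (N : ℕ) [NeZero N] :
    nu₃ N = (Finset.univ.filter fun x : ZMod N ↦ x ^ 2 + x + 1 = 0).card := by
  rw [nu₃, Nat.card_eq_fintype_card, Fintype.card_subtype]

/-- `μ(4) = 6`. [folklore] -/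
theorem gamma0Index_four : gamma0Index 4 = 6 :=
  gamma0Index_prime_pow (p := 2) (e := 2) Nat.prime_two two_ne_zero

/-- `μ(8) = 12`. [folklore] -/
theorem gamma0Index_eight : gamma0Index 8 = 12 :=
  gamma0Index_prime_pow (p := 2) (e := 3) Nat.prime_two three_ne_zero

/-- `μ(9) = 12`. [folklore] -/
theorem gamma0Index_nine : gamma0Index 9 = 12 :=
  gamma0Index_prime_pow (p := 3) (e := 2) Nat.prime_three two_ne_zero

/-- `μ(Γ₀(2)) = 3`, `ν_∞(Γ₀(2)) = 2`, `ν₂(Γ₀(2)) = 1`, `ν₃(Γ₀(2)) = 0`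
(Diamond–Shurman Figure 3.3, Cor. 3.7.2, §3.8). [folklore] -/
theorem gamma0_data_2 :
    gamma0Index 2 = 3 ∧ nuInfty 2 = 2 ∧ nu₂ 2 = 1 ∧ nu₃ 2 = 0 :=
  ⟨gamma0Index_prime Nat.prime_two,
    by decide, by rw [nu₂_eq_card]; decide, by rw [nu₃_eq_card]; decide⟩

/-- `μ(Γ₀(3)) = 4`, `ν_∞(Γ₀(3)) = 2`, `ν₂(Γ₀(3)) = 0`, `ν₃(Γ₀(3)) = 1`
(Diamond–Shurman Figure 3.3, Cor. 3.7.2, §3.8). [folklore] -/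
theorem gamma0_data_3 :
    gamma0Index 3 = 4 ∧ nuInfty 3 = 2 ∧ nu₂ 3 = 0 ∧ nu₃ 3 = 1 :=
  ⟨gamma0Index_prime Nat.prime_three,
    by decide, by rw [nu₂_eq_card]; decide, by rw [nu₃_eq_card]; decide⟩

/-- `μ(Γ₀(4)) = 6`, `ν_∞(Γ₀(4)) = 3`, `ν₂(Γ₀(4)) = 0`, `ν₃(Γ₀(4)) = 0`
(Diamond–Shurman Figure 3.3, Cor. 3.7.2, §3.8). [folklore] -/
theorem gamma0_data_4 :
    gamma0Index 4 = 6 ∧ nuInfty 4 = 3 ∧ nu₂ 4 = 0 ∧ nu₃ 4 = 0 :=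
  ⟨gamma0Index_four,
    by decide, by rw [nu₂_eq_card]; decide, by rw [nu₃_eq_card]; decide⟩

/-- `μ(Γ₀(5)) = 6`, `ν_∞(Γ₀(5)) = 2`, `ν₂(Γ₀(5)) = 2`, `ν₃(Γ₀(5)) = 0`
(Diamond–Shurman Figure 3.3, Cor. 3.7.2, §3.8). [folklore] -/
theorem gamma0_data_5 :
    gamma0Index 5 = 6 ∧ nuInfty 5 = 2 ∧ nu₂ 5 = 2 ∧ nu₃ 5 = 0 :=
  ⟨gamma0Index_prime (by norm_num),
    by decide, by rw [nu₂_eq_card]; decide, by rw [nu₃_eq_card]; decide⟩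

/-- `μ(Γ₀(6)) = 12`, `ν_∞(Γ₀(6)) = 4`, `ν₂(Γ₀(6)) = 0`, `ν₃(Γ₀(6)) = 0`
(Diamond–Shurman Figure 3.3, Cor. 3.7.2, §3.8). [folklore] -/
theorem gamma0_data_6 :
    gamma0Index 6 = 12 ∧ nuInfty 6 = 4 ∧ nu₂ 6 = 0 ∧ nu₃ 6 = 0 :=
  ⟨(gamma0Index_mul (m := 2) (n := 3) (by norm_num)).trans
      (by rw [gamma0Index_prime Nat.prime_two, gamma0Index_prime Nat.prime_three]),
    by decide, by rw [nu₂_eq_card]; decide, by rw [nu₃_eq_card]; decide⟩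

/-- `μ(Γ₀(7)) = 8`, `ν_∞(Γ₀(7)) = 2`, `ν₂(Γ₀(7)) = 0`, `ν₃(Γ₀(7)) = 2`
(Diamond–Shurman Figure 3.3, Cor. 3.7.2, §3.8). [folklore] -/
theorem gamma0_data_7 :
    gamma0Index 7 = 8 ∧ nuInfty 7 = 2 ∧ nu₂ 7 = 0 ∧ nu₃ 7 = 2 :=
  ⟨gamma0Index_prime (by norm_num),
    by decide, by rw [nu₂_eq_card]; decide, by rw [nu₃_eq_card]; decide⟩

/-- `μ(Γ₀(8)) = 12`, `ν_∞(Γ₀(8)) = 4`, `ν₂(Γ₀(8)) = 0`, `ν₃(Γ₀(8)) = 0`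
(Diamond–Shurman Figure 3.3, Cor. 3.7.2, §3.8). [folklore] -/
theorem gamma0_data_8 :
    gamma0Index 8 = 12 ∧ nuInfty 8 = 4 ∧ nu₂ 8 = 0 ∧ nu₃ 8 = 0 :=
  ⟨gamma0Index_eight,
    by decide, by rw [nu₂_eq_card]; decide, by rw [nu₃_eq_card]; decide⟩

/-- `μ(Γ₀(9)) = 12`, `ν_∞(Γ₀(9)) = 4`, `ν₂(Γ₀(9)) = 0`, `ν₃(Γ₀(9)) = 0`
(Diamond–Shurman Figure 3.3, Cor. 3.7.2, §3.8). [folklore] -/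
theorem gamma0_data_9 :
    gamma0Index 9 = 12 ∧ nuInfty 9 = 4 ∧ nu₂ 9 = 0 ∧ nu₃ 9 = 0 :=
  ⟨gamma0Index_nine,
    by decide, by rw [nu₂_eq_card]; decide, by rw [nu₃_eq_card]; decide⟩

/-- `μ(Γ₀(10)) = 18`, `ν_∞(Γ₀(10)) = 4`, `ν₂(Γ₀(10)) = 2`, `ν₃(Γ₀(10)) = 0`
(Diamond–Shurman Figure 3.3, Cor. 3.7.2, §3.8). [folklore] -/
theorem gamma0_data_10 :
    gamma0Index 10 = 18 ∧ nuInfty 10 = 4 ∧ nu₂ 10 = 2 ∧ nu₃ 10 = 0 :=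
  ⟨(gamma0Index_mul (m := 2) (n := 5) (by norm_num)).trans
      (by rw [gamma0Index_prime Nat.prime_two, gamma0Index_prime (by norm_num : Nat.Prime 5)]),
    by decide, by rw [nu₂_eq_card]; decide, by rw [nu₃_eq_card]; decide⟩

/-- `μ(Γ₀(11)) = 12`, `ν_∞(Γ₀(11)) = 2`, `ν₂(Γ₀(11)) = 0`, `ν₃(Γ₀(11)) = 0`
(Diamond–Shurman Figure 3.3, Cor. 3.7.2, §3.8). [folklore] -/
theorem gamma0_data_11 :
    gamma0Index 11 = 12 ∧ nuInfty 11 = 2 ∧ nu₂ 11 = 0 ∧ nu₃ 11 = 0 :=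
  ⟨gamma0Index_prime (by norm_num),
    by decide, by rw [nu₂_eq_card]; decide, by rw [nu₃_eq_card]; decide⟩

/-- `μ(Γ₀(12)) = 24`, `ν_∞(Γ₀(12)) = 6`, `ν₂(Γ₀(12)) = 0`, `ν₃(Γ₀(12)) = 0`
(Diamond–Shurman Figure 3.3, Cor. 3.7.2, §3.8). [folklore] -/
theorem gamma0_data_12 :
    gamma0Index 12 = 24 ∧ nuInfty 12 = 6 ∧ nu₂ 12 = 0 ∧ nu₃ 12 = 0 :=
  ⟨(gamma0Index_mul (m := 4) (n := 3) (by norm_num)).trans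
      (by rw [gamma0Index_four, gamma0Index_prime Nat.prime_three]),
    by decide, by rw [nu₂_eq_card]; decide, by rw [nu₃_eq_card]; decide⟩

/-- `μ(Γ₀(13)) = 14`, `ν_∞(Γ₀(13)) = 2`, `ν₂(Γ₀(13)) = 2`, `ν₃(Γ₀(13)) = 2`
(Diamond–Shurman Figure 3.3, Cor. 3.7.2, §3.8). [folklore] -/
theorem gamma0_data_13 :
    gamma0Index 13 = 14 ∧ nuInfty 13 = 2 ∧ nu₂ 13 = 2 ∧ nu₃ 13 = 2 :=
  ⟨gamma0Index_prime (by norm_num),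
    by decide, by rw [nu₂_eq_card]; decide, by rw [nu₃_eq_card]; decide⟩

/-- `μ(Γ₀(14)) = 24`, `ν_∞(Γ₀(14)) = 4`, `ν₂(Γ₀(14)) = 0`, `ν₃(Γ₀(14)) = 0`
(Diamond–Shurman Figure 3.3, Cor. 3.7.2, §3.8). [folklore] -/
theorem gamma0_data_14 :
    gamma0Index 14 = 24 ∧ nuInfty 14 = 4 ∧ nu₂ 14 = 0 ∧ nu₃ 14 = 0 :=
  ⟨(gamma0Index_mul (m := 2) (n := 7) (by norm_num)).trans
      (by rw [gamma0Index_prime Nat.prime_two, gamma0Index_prime (by norm_num : Nat.Prime 7)]),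
    by decide, by rw [nu₂_eq_card]; decide, by rw [nu₃_eq_card]; decide⟩

/-- `μ(Γ₀(15)) = 24`, `ν_∞(Γ₀(15)) = 4`, `ν₂(Γ₀(15)) = 0`, `ν₃(Γ₀(15)) = 0`
(Diamond–Shurman Figure 3.3, Cor. 3.7.2, §3.8). [folklore] -/
theorem gamma0_data_15 :
    gamma0Index 15 = 24 ∧ nuInfty 15 = 4 ∧ nu₂ 15 = 0 ∧ nu₃ 15 = 0 :=
  ⟨(gamma0Index_mul (m := 3) (n := 5) (by norm_num)).trans
      (by rw [gamma0Index_prime Nat.prime_three, gamma0Index_prime (by norm_num : Nat.Prime 5)]),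
    by decide, by rw [nu₂_eq_card]; decide, by rw [nu₃_eq_card]; decide⟩

/-- `μ(Γ₀(16)) = 24`, `ν_∞(Γ₀(16)) = 6`, `ν₂(Γ₀(16)) = 0`, `ν₃(Γ₀(16)) = 0`
(Diamond–Shurman Figure 3.3, Cor. 3.7.2, §3.8). [folklore] -/
theorem gamma0_data_16 :
    gamma0Index 16 = 24 ∧ nuInfty 16 = 6 ∧ nu₂ 16 = 0 ∧ nu₃ 16 = 0 :=
  ⟨gamma0Index_prime_pow (p := 2) (e := 4) Nat.prime_two (by norm_num),
    by decide, by rw [nu₂_eq_card]; decide, by rw [nu₃_eq_card]; decide⟩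

/-- `μ(Γ₀(18)) = 36`, `ν_∞(Γ₀(18)) = 8`, `ν₂(Γ₀(18)) = 0`, `ν₃(Γ₀(18)) = 0`
(Diamond–Shurman Figure 3.3, Cor. 3.7.2, §3.8). [folklore] -/
theorem gamma0_data_18 :
    gamma0Index 18 = 36 ∧ nuInfty 18 = 8 ∧ nu₂ 18 = 0 ∧ nu₃ 18 = 0 :=
  ⟨(gamma0Index_mul (m := 2) (n := 9) (by norm_num)).trans
      (by rw [gamma0Index_prime Nat.prime_two, gamma0Index_nine]),
    by decide, by rw [nu₂_eq_card]; decide, by rw [nu₃_eq_card]; decide⟩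

/-- `μ(Γ₀(20)) = 36`, `ν_∞(Γ₀(20)) = 6`, `ν₂(Γ₀(20)) = 0`, `ν₃(Γ₀(20)) = 0`
(Diamond–Shurman Figure 3.3, Cor. 3.7.2, §3.8). [folklore] -/
theorem gamma0_data_20 :
    gamma0Index 20 = 36 ∧ nuInfty 20 = 6 ∧ nu₂ 20 = 0 ∧ nu₃ 20 = 0 :=
  ⟨(gamma0Index_mul (m := 4) (n := 5) (by norm_num)).trans
      (by rw [gamma0Index_four, gamma0Index_prime (by norm_num : Nat.Prime 5)]),
    by decide, by rw [nu₂_eq_card]; decide, by rw [nu₃_eq_card]; decide⟩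

/-- `μ(Γ₀(24)) = 48`, `ν_∞(Γ₀(24)) = 8`, `ν₂(Γ₀(24)) = 0`, `ν₃(Γ₀(24)) = 0`
(Diamond–Shurman Figure 3.3, Cor. 3.7.2, §3.8). [folklore] -/
theorem gamma0_data_24 :
    gamma0Index 24 = 48 ∧ nuInfty 24 = 8 ∧ nu₂ 24 = 0 ∧ nu₃ 24 = 0 :=
  ⟨(gamma0Index_mul (m := 8) (n := 3) (by norm_num)).trans
      (by rw [gamma0Index_eight, gamma0Index_prime Nat.prime_three]),
    by decide, by rw [nu₂_eq_card]; decide, by rw [nu₃_eq_card]; decide⟩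

/-- `μ(Γ₀(25)) = 30`, `ν_∞(Γ₀(25)) = 6`, `ν₂(Γ₀(25)) = 2`, `ν₃(Γ₀(25)) = 0`
(Diamond–Shurman Figure 3.3, Cor. 3.7.2, §3.8). [folklore] -/
theorem gamma0_data_25 :
    gamma0Index 25 = 30 ∧ nuInfty 25 = 6 ∧ nu₂ 25 = 2 ∧ nu₃ 25 = 0 :=
  ⟨gamma0Index_prime_pow (p := 5) (e := 2) (by norm_num) two_ne_zero,
    by decide, by rw [nu₂_eq_card]; decide, by rw [nu₃_eq_card]; decide⟩

/-- `μ(Γ₀(27)) = 36`, `ν_∞(Γ₀(27)) = 6`, `ν₂(Γ₀(27)) = 0`, `ν₃(Γ₀(27)) = 0`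
(Diamond–Shurman Figure 3.3, Cor. 3.7.2, §3.8). [folklore] -/
theorem gamma0_data_27 :
    gamma0Index 27 = 36 ∧ nuInfty 27 = 6 ∧ nu₂ 27 = 0 ∧ nu₃ 27 = 0 :=
  ⟨gamma0Index_prime_pow (p := 3) (e := 3) Nat.prime_three three_ne_zero,
    by decide, by rw [nu₂_eq_card]; decide, by rw [nu₃_eq_card]; decide⟩

/-- `μ(Γ₀(32)) = 48`, `ν_∞(Γ₀(32)) = 8`, `ν₂(Γ₀(32)) = 0`, `ν₃(Γ₀(32)) = 0`
(Diamond–Shurman Figure 3.3, Cor. 3.7.2, §3.8). [folklore] -/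
theorem gamma0_data_32 :
    gamma0Index 32 = 48 ∧ nuInfty 32 = 8 ∧ nu₂ 32 = 0 ∧ nu₃ 32 = 0 :=
  ⟨gamma0Index_prime_pow (p := 2) (e := 5) Nat.prime_two (by norm_num),
    by decide, by rw [nu₂_eq_card]; decide, by rw [nu₃_eq_card]; decide⟩

/-- `μ(Γ₀(36)) = 72`, `ν_∞(Γ₀(36)) = 12`, `ν₂(Γ₀(36)) = 0`, `ν₃(Γ₀(36)) = 0`
(Diamond–Shurman Figure 3.3, Cor. 3.7.2, §3.8). [folklore] -/
theorem gamma0_data_36 :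
    gamma0Index 36 = 72 ∧ nuInfty 36 = 12 ∧ nu₂ 36 = 0 ∧ nu₃ 36 = 0 :=
  ⟨(gamma0Index_mul (m := 4) (n := 9) (by norm_num)).trans
      (by rw [gamma0Index_four, gamma0Index_nine]),
    by decide, by rw [nu₂_eq_card]; decide, by rw [nu₃_eq_card]; decide⟩

/-- **The genus-zero levels: `S₂(Γ₀(N)) = 0`, so `dim S₂(Γ₀(N)) = g(X₀(N)) = 0`, for
`N ∈ {2, …, 10, 12, 16, 18, 25}`** (all `N` with `g(X₀(N)) = 0` except `13`, where the two elliptic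
points of each kind are needed): for these `N`, `ν_∞ > ⌊μ/6⌋` (cuspidal Sturm bound) and
`12 + μ - 3ν₂ - 4ν₃ - 6ν_∞ = 0`. These are unconditional instances of the named fact
`finrank_cuspForm_two_eq_genusX0` (Diamond–Shurman Thm. 3.5.1; cf. p. 440 for `N = 2`).
[cite: DiamondShurman2005, Thm. 3.5.1] -/
theorem finrank_cuspForm_two_eq_genusX0_of_mem {N : ℕ} [NeZero N]
    (hN : N ∈ ({2, 3, 4, 5, 6, 7, 8, 9, 10, 12, 16, 18, 25} : Finset ℕ)) :
    finrank_cuspForm_two_eq_genusX0 N := by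
  simp only [Finset.mem_insert, Finset.mem_singleton] at hN
  rcases hN with rfl | rfl | rfl | rfl | rfl | rfl | rfl | rfl | rfl | rfl | rfl | rfl | rfl
  · obtain ⟨hμ, hν, h₂, h₃⟩ := gamma0_data_2
    exact finrank_cuspForm_two_eq_genusX0_of_le 2 (by omega) (by rw [genusX0, hμ, hν, h₂, h₃])
  · obtain ⟨hμ, hν, h₂, h₃⟩ := gamma0_data_3
    exact finrank_cuspForm_two_eq_genusX0_of_le 3 (by omega) (by rw [genusX0, hμ, hν, h₂, h₃])
  · obtain ⟨hμ, hν, h₂, h₃⟩ := gamma0_data_4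
    exact finrank_cuspForm_two_eq_genusX0_of_le 4 (by omega) (by rw [genusX0, hμ, hν, h₂, h₃])
  · obtain ⟨hμ, hν, h₂, h₃⟩ := gamma0_data_5
    exact finrank_cuspForm_two_eq_genusX0_of_le 5 (by omega) (by rw [genusX0, hμ, hν, h₂, h₃])
  · obtain ⟨hμ, hν, h₂, h₃⟩ := gamma0_data_6
    exact finrank_cuspForm_two_eq_genusX0_of_le 6 (by omega) (by rw [genusX0, hμ, hν, h₂, h₃])
  · obtain ⟨hμ, hν, h₂, h₃⟩ := gamma0_data_7
    exact finrank_cuspForm_two_eq_genusX0_of_le 7 (by omega) (by rw [genusX0, hμ, hν, h₂, h₃])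
  · obtain ⟨hμ, hν, h₂, h₃⟩ := gamma0_data_8
    exact finrank_cuspForm_two_eq_genusX0_of_le 8 (by omega) (by rw [genusX0, hμ, hν, h₂, h₃])
  · obtain ⟨hμ, hν, h₂, h₃⟩ := gamma0_data_9
    exact finrank_cuspForm_two_eq_genusX0_of_le 9 (by omega) (by rw [genusX0, hμ, hν, h₂, h₃])
  · obtain ⟨hμ, hν, h₂, h₃⟩ := gamma0_data_10
    exact finrank_cuspForm_two_eq_genusX0_of_le 10 (by omega) (by rw [genusX0, hμ, hν, h₂, h₃])
  · obtain ⟨hμ, hν, h₂, h₃⟩ := gamma0_data_12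
    exact finrank_cuspForm_two_eq_genusX0_of_le 12 (by omega) (by rw [genusX0, hμ, hν, h₂, h₃])
  · obtain ⟨hμ, hν, h₂, h₃⟩ := gamma0_data_16
    exact finrank_cuspForm_two_eq_genusX0_of_le 16 (by omega) (by rw [genusX0, hμ, hν, h₂, h₃])
  · obtain ⟨hμ, hν, h₂, h₃⟩ := gamma0_data_18
    exact finrank_cuspForm_two_eq_genusX0_of_le 18 (by omega) (by rw [genusX0, hμ, hν, h₂, h₃])
  · obtain ⟨hμ, hν, h₂, h₃⟩ := gamma0_data_25
    exact finrank_cuspForm_two_eq_genusX0_of_le 25 (by omega) (by rw [genusX0, hμ, hν, h₂, h₃])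

/-- **There are no weight-`2` cusp forms of level `N ≤ 10`**: `S₂(Γ₀(N)) = 0` for
`1 ≤ N ≤ 10` (the modular curves `X₀(N)`, `N ≤ 10`, have genus `0`; Diamond–Shurman Thm. 3.5.1 with
Figure 3.3, and p. 440 for the use of `S₂(Γ₀(2)) = 0`). Here proved by the cuspidal Sturm bound
(level `1`: Mathlib's `ModularForm.levelOne_weight_two_rank_zero` via `ModularCurveProofs`).
[cite: DiamondShurman2005, Thm. 3.5.1] -/
theorem cuspForm_two_gamma0_eq_zero_of_le_ten {N : ℕ} [NeZero N] (hN : N ≤ 10)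
    (f : CuspForm (Gamma0 N) 2) : f = 0 := by
  have hfd : FiniteDimensional ℂ (CuspForm (Gamma0 N) 2) := finiteDimensional_cuspForm_gamma0 N 2
  have h0 : Module.finrank ℂ (CuspForm (Gamma0 N) 2) = 0 := by
    have hN0 : N ≠ 0 := NeZero.ne N
    rcases Nat.lt_or_ge N 2 with h | h
    · obtain rfl : N = 1 := by omega
      have := finrank_cuspForm_two_eq_genusX0_one
      rwa [finrank_cuspForm_two_eq_genusX0, genusX0_one] at this
    · have hmem : N ∈ ({2, 3, 4, 5, 6, 7, 8, 9, 10, 12, 16, 18, 25} : Finset ℕ) := by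
        interval_cases N <;> decide
      have := finrank_cuspForm_two_eq_genusX0_of_mem hmem
      obtain ⟨hμ, hg⟩ : True ∧ genusX0 N = 0 := by
        refine ⟨trivial, ?_⟩
        interval_cases N
        · obtain ⟨hμ, hν, h₂, h₃⟩ := gamma0_data_2; rw [genusX0, hμ, hν, h₂, h₃]
        · obtain ⟨hμ, hν, h₂, h₃⟩ := gamma0_data_3; rw [genusX0, hμ, hν, h₂, h₃]
        · obtain ⟨hμ, hν, h₂, h₃⟩ := gamma0_data_4; rw [genusX0, hμ, hν, h₂, h₃]
        · obtain ⟨hμ, hν, h₂, h₃⟩ := gamma0_data_5; rw [genusX0, hμ, hν, h₂, h₃]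
        · obtain ⟨hμ, hν, h₂, h₃⟩ := gamma0_data_6; rw [genusX0, hμ, hν, h₂, h₃]
        · obtain ⟨hμ, hν, h₂, h₃⟩ := gamma0_data_7; rw [genusX0, hμ, hν, h₂, h₃]
        · obtain ⟨hμ, hν, h₂, h₃⟩ := gamma0_data_8; rw [genusX0, hμ, hν, h₂, h₃]
        · obtain ⟨hμ, hν, h₂, h₃⟩ := gamma0_data_9; rw [genusX0, hμ, hν, h₂, h₃]
        · obtain ⟨hμ, hν, h₂, h₃⟩ := gamma0_data_10; rw [genusX0, hμ, hν, h₂, h₃]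
      rwa [finrank_cuspForm_two_eq_genusX0, hg] at this
  exact finrank_zero_iff_forall_zero.mp h0 f

/-- **`dim S₂(Γ₀(N)) ≤ 1 = g(X₀(N))` for the genus-one levels
`N ∈ {11, 14, 15, 20, 24, 27, 32, 36}`** (the genus-one levels with `ν₂ = ν₃ = 0`; for
`17, 19, 21, 49` the elliptic points are needed): the cuspidal Sturm bound gives
`dim ≤ ⌊μ/6⌋ + 1 - ν_∞ = 1`, and `12 + μ - 6ν_∞ = 12`. This is the upper-bound half of
`finrank_cuspForm_two_eq_genusX0 N` for these `N`; equality needs a nonzero element, e.g.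
`η(τ)²η(11τ)²` for `N = 11` (Diamond–Shurman Prop. 3.2.2). [cite: DiamondShurman2005, Thm. 3.5.1] -/
theorem finrank_cuspForm_two_le_genusX0_of_mem {N : ℕ} [NeZero N]
    (hN : N ∈ ({11, 14, 15, 20, 24, 27, 32, 36} : Finset ℕ)) :
    Module.finrank ℂ (CuspForm (Gamma0 N) 2) ≤ genusX0 N ∧ genusX0 N = 1 := by
  simp only [Finset.mem_insert, Finset.mem_singleton] at hN
  rcases hN with rfl | rfl | rfl | rfl | rfl | rfl | rfl | rfl
  · obtain ⟨hμ, hν, h₂, h₃⟩ := gamma0_data_11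
    have hg : genusX0 11 = 1 := by rw [genusX0, hμ, hν, h₂, h₃]
    exact ⟨(finrank_cuspForm_two_gamma0_le 11).trans (by omega), hg⟩
  · obtain ⟨hμ, hν, h₂, h₃⟩ := gamma0_data_14
    have hg : genusX0 14 = 1 := by rw [genusX0, hμ, hν, h₂, h₃]
    exact ⟨(finrank_cuspForm_two_gamma0_le 14).trans (by omega), hg⟩
  · obtain ⟨hμ, hν, h₂, h₃⟩ := gamma0_data_15
    have hg : genusX0 15 = 1 := by rw [genusX0, hμ, hν, h₂, h₃]
    exact ⟨(finrank_cuspForm_two_gamma0_le 15).trans (by omega), hg⟩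
  · obtain ⟨hμ, hν, h₂, h₃⟩ := gamma0_data_20
    have hg : genusX0 20 = 1 := by rw [genusX0, hμ, hν, h₂, h₃]
    exact ⟨(finrank_cuspForm_two_gamma0_le 20).trans (by omega), hg⟩
  · obtain ⟨hμ, hν, h₂, h₃⟩ := gamma0_data_24
    have hg : genusX0 24 = 1 := by rw [genusX0, hμ, hν, h₂, h₃]
    exact ⟨(finrank_cuspForm_two_gamma0_le 24).trans (by omega), hg⟩
  · obtain ⟨hμ, hν, h₂, h₃⟩ := gamma0_data_27
    have hg : genusX0 27 = 1 := by rw [genusX0, hμ, hν, h₂, h₃]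
    exact ⟨(finrank_cuspForm_two_gamma0_le 27).trans (by omega), hg⟩
  · obtain ⟨hμ, hν, h₂, h₃⟩ := gamma0_data_32
    have hg : genusX0 32 = 1 := by rw [genusX0, hμ, hν, h₂, h₃]
    exact ⟨(finrank_cuspForm_two_gamma0_le 32).trans (by omega), hg⟩
  · obtain ⟨hμ, hν, h₂, h₃⟩ := gamma0_data_36
    have hg : genusX0 36 = 1 := by rw [genusX0, hμ, hν, h₂, h₃]
    exact ⟨(finrank_cuspForm_two_gamma0_le 36).trans (by omega), hg⟩

end Numerics

end Literature.NumberTheory.EllipticCurves.ModularForms
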